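import Summits.NavierStokesRegularity.NavierStokesRegularity.Theses.WakeRatchet

/-!
# LINE g9-2 «dissipation edge» — `stub_normalise` PROVED (shell-shift covariance of the rate statement)

Ideator ns-idea-1 g9.  Same namespace and the same `RateAt` / `StubNormalise` texts as the registered skeleton
`dissipation_edge_line.lean`; this file proves `stubNormalise_holds : StubNormalise` sorry-free (to be landed
`--supports stmt-NavierStokesRegularity-25647` by a prover; an ideator seat does not propose).  MODEL lattice only.
Mechanism: `isEternalVisc_shift` (tree) — `W̃_j(τ) := W_{j+n}(τ + 2n·log(1+ε₀))` is admissible with the SAME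
`ν̂` — and the physical-energy identity `E^{W̃}_k(σ) = Λ^{2n} e^{-2s} · E^{W}_{k+n}(σ + s)` (constant factor),
so tail bounds and tail conclusions transport between base shell `n` for `W` and base shell `0` for `W̃`.
-/

noncomputable section

set_option linter.dupNamespace false

namespace Summit.NavierStokesRegularity.NavierStokesRegularity.Cruxes.EternalViscousRate.DissipationEdge

open Set Filter Topology
open Literature.Analysis.FluidPDE Literature.Analysis.FluidPDE.TaoCascade

/-- (verbatim from the skeleton) -/
def RateAt (a ε₀ : ℝ) (α : Fin 4 → Fin 4 → Fin 4 → ℤ × ℤ × ℤ → ℝ) (νh : ℝ) (n : ℤ) : Prop :=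
  ∀ W : ℤ → ℝ → Em 4, IsEternalVisc ε₀ νh α W → UniformBound W → ∀ M : ℝ,
    (∀ σ : ℝ, ∑' k : ℕ, physEnergy ε₀ W (n + k) σ ≤ M) →
    ∀ σ : ℝ, ∑' k : ℕ, physEnergy ε₀ W (n + 1 + k) σ ≤ (1 + ε₀) ^ (-a) * M

/-- (verbatim from the skeleton) -/
def StubNormalise : Prop :=
  ∀ (a ε₀ : ℝ) (α : Fin 4 → Fin 4 → Fin 4 → ℤ × ℤ × ℤ → ℝ) (νh : ℝ) (n : ℤ),
    0 < ε₀ → 0 < νh → RateAt a ε₀ α νh 0 → RateAt a ε₀ α νh n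

/-- The constant factor picked up by physical energies under the shell shift `(j, τ) ↦ (j + n, τ + s)`. -/
def shiftFactor (ε₀ : ℝ) (n : ℤ) (s : ℝ) : ℝ :=
  (bigLam ε₀ ^ n) ^ 2 * Real.exp (-(2 * s))

/-- The shift factor is positive. -/
theorem shiftFactor_pos {ε₀ : ℝ} (hε : 0 < ε₀) (n : ℤ) (s : ℝ) : 0 < shiftFactor ε₀ n s := by
  have hb : 0 < bigLam ε₀ := bigLam_pos (by linarith)
  unfold shiftFactor
  have : 0 < bigLam ε₀ ^ n := zpow_pos hb n
  positivity

/-- Physical energies under the shell shift: `E^{W̃}_k(σ) = Λ^{2n} e^{-2s} E^{W}_{k+n}(σ+s)`. -/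
theorem physEnergy_shellShift {ε₀ : ℝ} (hε : 0 < ε₀) {W Wt : ℤ → ℝ → Em 4} {n : ℤ} {s : ℝ}
    (hWt : ∀ j τ, Wt j τ = W (j + n) (τ + s)) (k : ℤ) (σ : ℝ) :
    physEnergy ε₀ Wt k σ = shiftFactor ε₀ n s * physEnergy ε₀ W (k + n) (σ + s) := by
  have hb : 0 < bigLam ε₀ := bigLam_pos (by linarith)
  unfold physEnergy shiftFactor
  rw [hWt, zpow_add₀ hb.ne', Real.exp_neg]
  have h1 : Real.exp (2 * (σ + s)) = Real.exp (2 * σ) * Real.exp (2 * s) := by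
    rw [← Real.exp_add]; ring_nf
  rw [h1]
  have hk : bigLam ε₀ ^ k ≠ 0 := zpow_ne_zero k hb.ne'
  have hn : bigLam ε₀ ^ n ≠ 0 := zpow_ne_zero n hb.ne'
  have he : Real.exp (2 * s) ≠ 0 := (Real.exp_pos _).ne'
  field_simp

/-- **`StubNormalise` holds.** -/
theorem stubNormalise_holds : StubNormalise := by
  intro a ε₀ α νh n hε hν h0 W hW hUB M hM σ
  have hvis := isEternalVisc_shift (m := 4) (by linarith : -1 < ε₀) hW n
  -- name the shifted solution through a characterising equation (keeps rewriting robust)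
  have hWt : ∀ j τ, (fun j τ => W (j + n) (τ + 2 * (n : ℝ) * Real.log (1 + ε₀))) j τ
      = W (j + n) (τ + 2 * (n : ℝ) * Real.log (1 + ε₀)) := fun _ _ => rfl
  have hUBt : UniformBound (fun j τ => W (j + n) (τ + 2 * (n : ℝ) * Real.log (1 + ε₀))) := by
    obtain ⟨B, hB⟩ := hUB
    exact ⟨B, fun k τ => hB _ _⟩
  have hρ := shiftFactor_pos hε n (2 * (n : ℝ) * Real.log (1 + ε₀))
  -- the tail hypothesis transports to base shell 0 with bound ρ·M
  have hMt : ∀ τ : ℝ, ∑' k : ℕ,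
      physEnergy ε₀ (fun j τ => W (j + n) (τ + 2 * (n : ℝ) * Real.log (1 + ε₀))) (0 + k) τ
        ≤ shiftFactor ε₀ n (2 * (n : ℝ) * Real.log (1 + ε₀)) * M := by
    intro τ
    have hc : ∀ k : ℕ,
        physEnergy ε₀ (fun j τ => W (j + n) (τ + 2 * (n : ℝ) * Real.log (1 + ε₀))) (0 + k) τ
          = shiftFactor ε₀ n (2 * (n : ℝ) * Real.log (1 + ε₀))
            * physEnergy ε₀ W (n + k) (τ + 2 * (n : ℝ) * Real.log (1 + ε₀)) := by
      intro k
      rw [physEnergy_shellShift hε hWt, show (0 : ℤ) + (k : ℤ) + n = n + k by ring]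
    rw [tsum_congr hc, tsum_mul_left]
    exact mul_le_mul_of_nonneg_left (hM _) hρ.le
  have hconc := h0 _ hvis hUBt _ hMt (σ - 2 * (n : ℝ) * Real.log (1 + ε₀))
  have hc' : ∀ k : ℕ,
      physEnergy ε₀ (fun j τ => W (j + n) (τ + 2 * (n : ℝ) * Real.log (1 + ε₀))) (0 + 1 + k)
          (σ - 2 * (n : ℝ) * Real.log (1 + ε₀))
        = shiftFactor ε₀ n (2 * (n : ℝ) * Real.log (1 + ε₀)) * physEnergy ε₀ W (n + 1 + k) σ := by
    intro k
    rw [physEnergy_shellShift hε hWt, show (0 : ℤ) + 1 + (k : ℤ) + n = n + 1 + k by ring,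
      show σ - 2 * (n : ℝ) * Real.log (1 + ε₀) + 2 * (n : ℝ) * Real.log (1 + ε₀) = σ by ring]
  rw [tsum_congr hc', tsum_mul_left] at hconc
  have h2 : shiftFactor ε₀ n (2 * (n : ℝ) * Real.log (1 + ε₀)) * ∑' k : ℕ, physEnergy ε₀ W (n + 1 + k) σ
      ≤ shiftFactor ε₀ n (2 * (n : ℝ) * Real.log (1 + ε₀)) * ((1 + ε₀) ^ (-a) * M) := by
    calc _ ≤ (1 + ε₀) ^ (-a) * (shiftFactor ε₀ n (2 * (n : ℝ) * Real.log (1 + ε₀)) * M) := hconc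
      _ = _ := by ring
  exact le_of_mul_le_mul_left h2 hρ

/-- The registered stub `stub_normalise : StubNormalise` of crux ⟨stmt-NavierStokesRegularity-25647⟩, by name
(= `stubNormalise_holds`; alias added by the landing hand so the registry credits the stub). -/
theorem stub_normalise : StubNormalise := stubNormalise_holds

end Summit.NavierStokesRegularity.NavierStokesRegularity.Cruxes.EternalViscousRate.DissipationEdge

end
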